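import Literature.Probability.RandomPlanarGeometry.SAWCountZdSymbolSixRun
import Literature.Probability.RandomPlanarGeometry.SAWCountZdSymbolTopRunTypes
import Literature.Probability.RandomPlanarGeometry.SAWCountZdSymbolThirdCoefficient
import HarnessLib

/-!
# THE THIRD-LAYER TOP CENSUS `T'_j` FOR EVERY `j ≥ 3`: the five-adjacency vectors on `2j` letters are of run type `{6}`, `{5,2}`, `{4,3}` or `{4,2,2}`

Topic `Literature/Probability/RandomPlanarGeometry` (the «SYMBOL POLYNOMIALITY» programme, third layer; on `SAWCountZdSymbolSixRun.lean` (a-p1 g27: `sixRunVec`,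
`card_shapeClass_sixRunVec`), `SAWCountZdSymbolTopRunTypes.lean` (a-p1 g27: `fivePairVec`, `fourThreeVec`, `fourTwoTwoVec` and their counts),
`SAWCountZdSymbolThirdCoefficient.lean` (a-p1 g26: `thirdShapeSumTop`), η `SAWCountZdSymbolDegree.lean` (`four_le_of_zero_block`), `SAWCountZdSymbolSecondTopCount.lean`'s
pattern (a-p1 g26: classification + reindexed sum)).

PRINTED CONTEXT (locators only; nothing is quoted digit-for-digit). Madras–Slade (1993) §1.1 eq. (1.1.8) p. 5, Definition 1.2.4, §1.2 p. 10; Clisby–Liang–Slade (2007)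
§3.3 eqs. (29)/(31); Stanley EC1 §1.2 (compositions: placements of runs). NOT IN PRINT as far as the lane's desks could locate: the statements below.

THE THEOREM. The third-layer TOP corner `T'_j = thirdShapeSumTop j` of `SAWCountZdSymbolThirdCoefficient.coeff_symbolPoly_two_mul_sub_five` sums the classes on
`2j` letters with five adjacencies. ★ `exists_runType_of_mem_shapeClass` — a valid vector with `m − 5` breaks and a non-empty class is a six-run vector (`2j−5` of them),
a five-run + isolated pair (`(2j−5)(2j−6)`, indexed by `idx52` on ordered pairs of distinct slots), a block + run of three (`(2j−5)(2j−6)`, `idx43`) or a block +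
two isolated pairs (`(2j−5)(j−3)(2j−7)` = `3·C(2j−5,3)`, indexed by `idx422` on a slot for the block and an increasing pair of other slots, `tripleSlots`,
★ `card_tripleSlots`). With the four counts of the two companion files this gives ★★★ `thirdShapeSumTop_add`:
**`T'_j + ((2j−5)(1 + 2(2j−6)) + N_j)·2(2j−7)‼2^{2j−3} = (2j−5)(3(2j−5)‼2^{2j−2} + 4(2j−7)‼2^{2j−3}) + (2j−5)(2j−6)((2j−5)‼2^{2j−1} + (2j−5)‼2^{2j−2})`**
**`+ N_j((2j−5)‼2^{2j−2} + (2j−9)‼2^{2j−4})`**, `N_j = (2j−5)(j−3)(2j−7)`, for every `j ≥ 3` — i.e. `T_j = 2^{2j−2}[(2j−5)(3a+b) + (2j−6)(2j−5)(2a−b) +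
(2j−6)(2j−5)(a−b) + N_j(a−b+c/4)]` of FINDING-ZD-SYMBOL-POLYNOMIALITY §16 (i) (`a, b, c = (2j−5)‼, (2j−7)‼, (2j−9)‼`): the lane's censuses
`T'_3 … T'_7 = 64, 5040, 355200, 24380160, 1753436160` and the BLIND-predicted `T'_8 = M_8(16,11) = 135 440 363 520` (register «Am. BR» cell BR-2, kit j306082 HIT) are its
instances (`thirdShapeSumTop_values`). The third of the three census identities that make the THIRD CANCELLATION unconditional.
Tool notions (the lane's): `idx52`, `idx43`, `pairSlots`, `tripleSlots`, `idx422`.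

THIS FILE (lane «pcv-sawmu», a-p1 g27; all PROVED, standard axioms): `idx52`, `idx52_spec`, `idx52_inj`, `idx43`, `idx43_spec`, `idx43_inj`, `pairSlots`, `card_pairSlots`,
`tripleSlots`, `mem_tripleSlots`, ★ `card_tripleSlots`, `idx422`, `idx422_spec`, `idx422_inj`, `at_true` (private), `sixRunVec_inj`, `fivePairVec_inj`, `fourThreeVec_inj`,
`fourTwoTwoVec_inj`, `sixRunVec_ne_fivePairVec`, `sixRunVec_ne_fourThreeVec`, `sixRunVec_ne_fourTwoTwoVec`, `fivePairVec_ne_fourThreeVec`, `fivePairVec_ne_fourTwoTwoVec`,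
`fourThreeVec_ne_fourTwoTwoVec`, ★ `exists_runType_of_mem_shapeClass`, ★★★ `thirdShapeSumTop_add`, `thirdShapeSumTop_values`.
[cite: MadrasSlade1993, §1.1 eq. (1.1.8) p. 5; Definition 1.2.4; §1.2 (p. 10)] [cite: ClisbyLiangSlade2007, §3.3 eqs. (29)/(31)] [cite: Stanley2012EC1, §1.2]

Provenance: lane «pcv-sawmu», a-p1 g27 (2026-08-28).
-/

open Finset
open scoped BigOperators
open Literature.Probability.LatticeModels
open Literature.Probability.RandomPlanarGeometry.SAW
open Literature.Probability.Percolation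

namespace Literature.Probability.RandomPlanarGeometry.SAW.Zd

namespace WordTypes

variable {m : ℕ}

/-! ### The index maps -/

/-- `{5,2}` data from an ordered pair of distinct slots: the pair before the five-run (`b < a`: `s = a + 1`, `q = b`) or after it (`a < b`: `s = a`, `q = b + 4`).
[cite: Stanley2012EC1, §1.2; lane tool notion] -/
def idx52 (ab : ℕ × ℕ) : ℕ × ℕ := if ab.2 < ab.1 then (ab.1 + 1, ab.2) else (ab.1, ab.2 + 4)

/-- `{4,3}` data from an ordered pair of distinct slots: the run of three before the block (`b < a`: `i = a + 2`, `q = b`) or after it (`a < b`: `i = a`, `q = b + 3`).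
[cite: Stanley2012EC1, §1.2; lane tool notion] -/
def idx43 (ab : ℕ × ℕ) : ℕ × ℕ := if ab.2 < ab.1 then (ab.1 + 2, ab.2) else (ab.1, ab.2 + 3)

/-- The `{5,2}` data of an off-diagonal pair is valid and separated. [cite: Stanley2012EC1, §1.2; lane plumbing] -/
theorem idx52_spec {ab : ℕ × ℕ} (hab : ab ∈ (Finset.range (m - 5)).offDiag) :
    (idx52 ab).1 + 5 ≤ m ∧ ((idx52 ab).2 + 2 ≤ (idx52 ab).1 ∨ (idx52 ab).1 + 5 ≤ (idx52 ab).2) ∧ (idx52 ab).2 + 2 ≤ m := by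
  rw [Finset.mem_offDiag, Finset.mem_range, Finset.mem_range] at hab
  unfold idx52
  split_ifs with h <;> simp only <;> omega

/-- `idx52` is injective on the off-diagonal pairs. [cite: Stanley2012EC1, §1.2; lane plumbing] -/
theorem idx52_inj {ab ab' : ℕ × ℕ} (h : idx52 ab = idx52 ab') : ab = ab' := by
  unfold idx52 at h
  obtain ⟨a, b⟩ := ab
  obtain ⟨a', b'⟩ := ab'
  simp only at h ⊢
  split_ifs at h with h1 h2 h2 <;> simp only [Prod.mk.injEq] at h ⊢ <;> omega

/-- The `{4,3}` data of an off-diagonal pair is valid and separated. [cite: Stanley2012EC1, §1.2; lane plumbing] -/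
theorem idx43_spec {ab : ℕ × ℕ} (hab : ab ∈ (Finset.range (m - 5)).offDiag) :
    (idx43 ab).1 + 4 ≤ m ∧ ((idx43 ab).2 + 3 ≤ (idx43 ab).1 ∨ (idx43 ab).1 + 4 ≤ (idx43 ab).2) ∧ (idx43 ab).2 + 3 ≤ m := by
  rw [Finset.mem_offDiag, Finset.mem_range, Finset.mem_range] at hab
  unfold idx43
  split_ifs with h <;> simp only <;> omega

/-- `idx43` is injective on the off-diagonal pairs. [cite: Stanley2012EC1, §1.2; lane plumbing] -/
theorem idx43_inj {ab ab' : ℕ × ℕ} (h : idx43 ab = idx43 ab') : ab = ab' := by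
  unfold idx43 at h
  obtain ⟨a, b⟩ := ab
  obtain ⟨a', b'⟩ := ab'
  simp only at h ⊢
  split_ifs at h with h1 h2 h2 <;> simp only [Prod.mk.injEq] at h ⊢ <;> omega

/-- The increasing pairs of slots `b < c < n`. [cite: Stanley2012EC1, §1.2; lane tool notion] -/
def pairSlots (n : ℕ) : Finset (ℕ × ℕ) := ((Finset.range n) ×ˢ (Finset.range n)).filter fun bc => bc.1 < bc.2

/-- `#pairSlots n = n(n−1)/2` (Gauss). [cite: Stanley2012EC1, §1.2; lane lemma] -/
theorem card_pairSlots (n : ℕ) : (pairSlots n).card = n * (n - 1) / 2 := by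
  rw [← Finset.sum_range_id n]
  have h : (pairSlots n).card = ((Finset.range n).sigma fun c => Finset.range c).card := by
    refine Finset.card_nbij' (fun bc => ⟨bc.2, bc.1⟩) (fun x => (x.2, x.1)) (fun bc hbc => ?_) (fun x hx => ?_) (fun _ _ => rfl) (fun _ _ => rfl)
    · unfold pairSlots at hbc
      rw [Finset.mem_coe, Finset.mem_filter, Finset.mem_product, Finset.mem_range, Finset.mem_range] at hbc
      rw [Finset.mem_coe, Finset.mem_sigma, Finset.mem_range, Finset.mem_range]
      exact ⟨hbc.1.2, hbc.2⟩
    · obtain ⟨c, b⟩ := x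
      rw [Finset.mem_coe, Finset.mem_sigma, Finset.mem_range, Finset.mem_range] at hx
      unfold pairSlots
      rw [Finset.mem_coe, Finset.mem_filter, Finset.mem_product, Finset.mem_range, Finset.mem_range]
      simp only at hx ⊢
      exact ⟨⟨by omega, hx.1⟩, hx.2⟩
  rw [h, Finset.card_sigma]
  exact Finset.sum_congr rfl fun c _ => Finset.card_range c

/-- The `{4,2,2}` slot data: an increasing pair of slots `(b, c)` for the two isolated pairs and a third slot `a` for the block.
[cite: Stanley2012EC1, §1.2; lane tool notion] -/
def tripleSlots (n : ℕ) : Finset (Σ _ : ℕ × ℕ, ℕ) := (pairSlots n).sigma fun bc => ((Finset.range n).erase bc.1).erase bc.2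

/-- Membership in `tripleSlots`. [cite: Stanley2012EC1, §1.2; lane plumbing] -/
theorem mem_tripleSlots {n : ℕ} {x : Σ _ : ℕ × ℕ, ℕ} :
    x ∈ tripleSlots n ↔ x.1.1 < x.1.2 ∧ x.1.2 < n ∧ x.2 < n ∧ x.2 ≠ x.1.1 ∧ x.2 ≠ x.1.2 := by
  unfold tripleSlots pairSlots
  rw [Finset.mem_sigma, Finset.mem_filter, Finset.mem_product, Finset.mem_range, Finset.mem_range, Finset.mem_erase, Finset.mem_erase, Finset.mem_range]
  constructor
  · rintro ⟨⟨⟨-, h2⟩, h3⟩, h4, h5, h6⟩; exact ⟨h3, h2, h6, h5, h4⟩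
  · rintro ⟨h3, h2, h6, h5, h4⟩; exact ⟨⟨⟨by omega, h2⟩, h3⟩, h4, h5, h6⟩

/-- ★ `#tripleSlots n = (n(n−1)/2)·(n−2)` = `3·C(n,3)`. [cite: Stanley2012EC1, §1.2; lane lemma] -/
theorem card_tripleSlots (n : ℕ) : (tripleSlots n).card = n * (n - 1) / 2 * (n - 2) := by
  unfold tripleSlots
  rw [Finset.card_sigma, Finset.sum_const_nat (m := n - 2) (fun bc hbc => ?_), card_pairSlots]
  unfold pairSlots at hbc
  rw [Finset.mem_filter, Finset.mem_product, Finset.mem_range, Finset.mem_range] at hbc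
  rw [Finset.card_erase_of_mem (Finset.mem_erase.2 ⟨by omega, Finset.mem_range.2 hbc.1.2⟩), Finset.card_erase_of_mem (Finset.mem_range.2 hbc.1.1), Finset.card_range]
  omega

/-- `{4,2,2}` data from slot data: decompress the three groups (the block carries three adjacencies, each group is followed by a gap).
[cite: Stanley2012EC1, §1.2; lane tool notion] -/
def idx422 (x : Σ _ : ℕ × ℕ, ℕ) : ℕ × ℕ × ℕ :=
  (x.2 + (if x.1.1 < x.2 then 1 else 0) + (if x.1.2 < x.2 then 1 else 0), x.1.1 + (if x.2 < x.1.1 then 3 else 0), x.1.2 + (if x.2 < x.1.2 then 3 else 0) + 1)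

/-- The `{4,2,2}` data of a slot triple is valid: block in range, both pairs separated from it, pairs two apart. [cite: Stanley2012EC1, §1.2; lane plumbing] -/
theorem idx422_spec {n : ℕ} (hn : n + 5 = m) {x : Σ _ : ℕ × ℕ, ℕ} (hx : x ∈ tripleSlots n) :
    (idx422 x).1 + 4 ≤ m ∧ SepAdj m (idx422 x).1 (idx422 x).2.1 ∧ SepAdj m (idx422 x).1 (idx422 x).2.2 ∧ (idx422 x).2.1 + 2 ≤ (idx422 x).2.2 := by
  rw [mem_tripleSlots] at hx
  unfold idx422 SepAdj
  obtain ⟨⟨b, c⟩, a⟩ := x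
  simp only at hx ⊢
  split_ifs <;> omega

/-- `idx422` is injective on the slot triples. [cite: Stanley2012EC1, §1.2; lane plumbing] -/
theorem idx422_inj {n : ℕ} {x x' : Σ _ : ℕ × ℕ, ℕ} (hx : x ∈ tripleSlots n) (hx' : x' ∈ tripleSlots n) (h : idx422 x = idx422 x') : x = x' := by
  rw [mem_tripleSlots] at hx hx'
  unfold idx422 at h
  obtain ⟨⟨b, c⟩, a⟩ := x
  obtain ⟨⟨b', c'⟩, a'⟩ := x'
  simp only [Prod.mk.injEq] at hx hx' h ⊢
  have hb : b = b' := by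
    rcases h with ⟨h1, h2, h3⟩; split_ifs at h1 h2 h3 <;> omega
  have hc : c = c' := by
    rcases h with ⟨h1, h2, h3⟩; split_ifs at h1 h2 h3 <;> omega
  have ha : a = a' := by
    rcases h with ⟨h1, h2, h3⟩; split_ifs at h1 h2 h3 <;> omega
  subst hb hc ha
  rfl

/-! ### Injectivity and disjointness of the four families -/

/-- Equal vectors: a true entry of one is a true entry of the other. [cite: MadrasSlade1993, Definition 1.2.4; lane plumbing] -/
private theorem at_true {A B : Fin m → Bool} (h : A = B) (x : ℕ) (hx : x < m) (hA : A ⟨x, hx⟩ = true) : B ⟨x, hx⟩ = true := h ▸ hA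

/-- `sixRunVec m` is injective on `s + 6 ≤ m`. [cite: MadrasSlade1993, Definition 1.2.4; lane plumbing] -/
theorem sixRunVec_inj {s s' : ℕ} (hs : s + 6 ≤ m) (hs' : s' + 6 ≤ m) (h : sixRunVec m s = sixRunVec m s') : s = s' := by
  have f1 := at_true h (s + 4) (by omega) ((sixRunVec_eq_true_iff _).2 ⟨by simp only; omega, by simp only; omega⟩)
  have f2 := at_true h.symm (s' + 4) (by omega) ((sixRunVec_eq_true_iff _).2 ⟨by simp only; omega, by simp only; omega⟩)
  rw [sixRunVec_eq_true_iff] at f1 f2; simp only at f1 f2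
  omega

/-- `fivePairVec m` is injective on valid separated data. [cite: MadrasSlade1993, Definition 1.2.4; lane plumbing] -/
theorem fivePairVec_inj {s q s' q' : ℕ} (hs : s + 5 ≤ m) (hq : (q + 2 ≤ s ∨ s + 5 ≤ q) ∧ q + 2 ≤ m) (_hs' : s' + 5 ≤ m) (hq' : (q' + 2 ≤ s' ∨ s' + 5 ≤ q') ∧ q' + 2 ≤ m)
    (h : fivePairVec m s q = fivePairVec m s' q') : s = s' ∧ q = q' := by
  have f0 := at_true h s (by omega) ((fivePairVec_eq_true_iff _).2 (Or.inl ⟨le_rfl, by simp only; omega⟩))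
  have f1 := at_true h (s + 1) (by omega) ((fivePairVec_eq_true_iff _).2 (Or.inl ⟨by simp only; omega, by simp only; omega⟩))
  have f2 := at_true h (s + 2) (by omega) ((fivePairVec_eq_true_iff _).2 (Or.inl ⟨by simp only; omega, by simp only; omega⟩))
  have f3 := at_true h (s + 3) (by omega) ((fivePairVec_eq_true_iff _).2 (Or.inl ⟨by simp only; omega, le_rfl⟩))
  have f4 := at_true h q (by omega) ((fivePairVec_eq_true_iff _).2 (Or.inr rfl))
  rw [fivePairVec_eq_true_iff] at f0 f1 f2 f3 f4; simp only at f0 f1 f2 f3 f4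
  omega

/-- `fourThreeVec m` is injective on valid separated data. [cite: MadrasSlade1993, Definition 1.2.4; lane plumbing] -/
theorem fourThreeVec_inj {i q i' q' : ℕ} (hi : i + 4 ≤ m) (hq : (q + 3 ≤ i ∨ i + 4 ≤ q) ∧ q + 3 ≤ m) (_hi' : i' + 4 ≤ m) (hq' : (q' + 3 ≤ i' ∨ i' + 4 ≤ q') ∧ q' + 3 ≤ m)
    (h : fourThreeVec m i q = fourThreeVec m i' q') : i = i' ∧ q = q' := by
  have f0 := at_true h i (by omega) ((fourThreeVec_eq_true_iff _).2 (Or.inl ⟨le_rfl, by simp only; omega⟩))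
  have f1 := at_true h (i + 1) (by omega) ((fourThreeVec_eq_true_iff _).2 (Or.inl ⟨by simp only; omega, by simp only; omega⟩))
  have f2 := at_true h (i + 2) (by omega) ((fourThreeVec_eq_true_iff _).2 (Or.inl ⟨by simp only; omega, le_rfl⟩))
  have f3 := at_true h q (by omega) ((fourThreeVec_eq_true_iff _).2 (Or.inr ⟨le_rfl, by simp only; omega⟩))
  have f4 := at_true h (q + 1) (by omega) ((fourThreeVec_eq_true_iff _).2 (Or.inr ⟨by simp only; omega, le_rfl⟩))
  rw [fourThreeVec_eq_true_iff] at f0 f1 f2 f3 f4; simp only at f0 f1 f2 f3 f4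
  omega

/-- `fourTwoTwoVec m` is injective on valid separated data with `q + 2 ≤ q'`. [cite: MadrasSlade1993, Definition 1.2.4; lane plumbing] -/
theorem fourTwoTwoVec_inj {i q q' i₂ q₂ q₂' : ℕ} (hi : i + 4 ≤ m) (hq : SepAdj m i q) (hq' : SepAdj m i q') (hqq : q + 2 ≤ q') (_hi₂ : i₂ + 4 ≤ m) (hq₂ : SepAdj m i₂ q₂)
    (hq₂' : SepAdj m i₂ q₂') (hqq₂ : q₂ + 2 ≤ q₂') (h : fourTwoTwoVec m i q q' = fourTwoTwoVec m i₂ q₂ q₂') : i = i₂ ∧ q = q₂ ∧ q' = q₂' := by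
  unfold SepAdj at hq hq' hq₂ hq₂'
  have f0 := at_true h i (by omega) ((fourTwoTwoVec_eq_true_iff _).2 (Or.inl ⟨le_rfl, by simp only; omega⟩))
  have f1 := at_true h (i + 1) (by omega) ((fourTwoTwoVec_eq_true_iff _).2 (Or.inl ⟨by simp only; omega, by simp only; omega⟩))
  have f2 := at_true h (i + 2) (by omega) ((fourTwoTwoVec_eq_true_iff _).2 (Or.inl ⟨by simp only; omega, le_rfl⟩))
  have f3 := at_true h q (by omega) ((fourTwoTwoVec_eq_true_iff _).2 (Or.inr (Or.inl rfl)))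
  have f4 := at_true h q' (by omega) ((fourTwoTwoVec_eq_true_iff _).2 (Or.inr (Or.inr rfl)))
  rw [fourTwoTwoVec_eq_true_iff] at f0 f1 f2 f3 f4; simp only at f0 f1 f2 f3 f4
  omega

/-- A six-run vector is not a `{5,2}` vector. [cite: MadrasSlade1993, Definition 1.2.4; lane plumbing] -/
theorem sixRunVec_ne_fivePairVec {s s' q : ℕ} (hs : s + 6 ≤ m) (_hs' : s' + 5 ≤ m) (hq : (q + 2 ≤ s' ∨ s' + 5 ≤ q) ∧ q + 2 ≤ m) :
    sixRunVec m s ≠ fivePairVec m s' q := by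
  intro h
  have f0 := at_true h s (by omega) ((sixRunVec_eq_true_iff _).2 ⟨le_rfl, by simp only; omega⟩)
  have f1 := at_true h (s + 1) (by omega) ((sixRunVec_eq_true_iff _).2 ⟨by simp only; omega, by simp only; omega⟩)
  have f2 := at_true h (s + 2) (by omega) ((sixRunVec_eq_true_iff _).2 ⟨by simp only; omega, by simp only; omega⟩)
  have f3 := at_true h (s + 3) (by omega) ((sixRunVec_eq_true_iff _).2 ⟨by simp only; omega, by simp only; omega⟩)
  have f4 := at_true h (s + 4) (by omega) ((sixRunVec_eq_true_iff _).2 ⟨by simp only; omega, le_rfl⟩)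
  rw [fivePairVec_eq_true_iff] at f0 f1 f2 f3 f4; simp only at f0 f1 f2 f3 f4
  omega

/-- A six-run vector is not a `{4,3}` vector. [cite: MadrasSlade1993, Definition 1.2.4; lane plumbing] -/
theorem sixRunVec_ne_fourThreeVec {s i q : ℕ} (hs : s + 6 ≤ m) (_hi : i + 4 ≤ m) (hq : (q + 3 ≤ i ∨ i + 4 ≤ q) ∧ q + 3 ≤ m) :
    sixRunVec m s ≠ fourThreeVec m i q := by
  intro h
  have f0 := at_true h s (by omega) ((sixRunVec_eq_true_iff _).2 ⟨le_rfl, by simp only; omega⟩)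
  have f1 := at_true h (s + 1) (by omega) ((sixRunVec_eq_true_iff _).2 ⟨by simp only; omega, by simp only; omega⟩)
  have f2 := at_true h (s + 2) (by omega) ((sixRunVec_eq_true_iff _).2 ⟨by simp only; omega, by simp only; omega⟩)
  have f3 := at_true h (s + 3) (by omega) ((sixRunVec_eq_true_iff _).2 ⟨by simp only; omega, by simp only; omega⟩)
  have f4 := at_true h (s + 4) (by omega) ((sixRunVec_eq_true_iff _).2 ⟨by simp only; omega, le_rfl⟩)
  rw [fourThreeVec_eq_true_iff] at f0 f1 f2 f3 f4; simp only at f0 f1 f2 f3 f4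
  omega

/-- A six-run vector is not a `{4,2,2}` vector. [cite: MadrasSlade1993, Definition 1.2.4; lane plumbing] -/
theorem sixRunVec_ne_fourTwoTwoVec {s i q q' : ℕ} (hs : s + 6 ≤ m) (_hi : i + 4 ≤ m) (_hq : SepAdj m i q) (hq' : SepAdj m i q') (hqq : q + 2 ≤ q') :
    sixRunVec m s ≠ fourTwoTwoVec m i q q' := by
  intro h
  unfold SepAdj at hq'
  have f0 := at_true h s (by omega) ((sixRunVec_eq_true_iff _).2 ⟨le_rfl, by simp only; omega⟩)
  have f1 := at_true h (s + 1) (by omega) ((sixRunVec_eq_true_iff _).2 ⟨by simp only; omega, by simp only; omega⟩)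
  have f2 := at_true h (s + 2) (by omega) ((sixRunVec_eq_true_iff _).2 ⟨by simp only; omega, by simp only; omega⟩)
  have f3 := at_true h (s + 3) (by omega) ((sixRunVec_eq_true_iff _).2 ⟨by simp only; omega, by simp only; omega⟩)
  have f4 := at_true h (s + 4) (by omega) ((sixRunVec_eq_true_iff _).2 ⟨by simp only; omega, le_rfl⟩)
  rw [fourTwoTwoVec_eq_true_iff] at f0 f1 f2 f3 f4; simp only at f0 f1 f2 f3 f4
  omega

/-- A `{5,2}` vector is not a `{4,3}` vector. [cite: MadrasSlade1993, Definition 1.2.4; lane plumbing] -/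
theorem fivePairVec_ne_fourThreeVec {s q i q' : ℕ} (hs : s + 5 ≤ m) (_hq : (q + 2 ≤ s ∨ s + 5 ≤ q) ∧ q + 2 ≤ m) (_hi : i + 4 ≤ m)
    (hq' : (q' + 3 ≤ i ∨ i + 4 ≤ q') ∧ q' + 3 ≤ m) : fivePairVec m s q ≠ fourThreeVec m i q' := by
  intro h
  have f0 := at_true h s (by omega) ((fivePairVec_eq_true_iff _).2 (Or.inl ⟨le_rfl, by simp only; omega⟩))
  have f1 := at_true h (s + 1) (by omega) ((fivePairVec_eq_true_iff _).2 (Or.inl ⟨by simp only; omega, by simp only; omega⟩))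
  have f2 := at_true h (s + 2) (by omega) ((fivePairVec_eq_true_iff _).2 (Or.inl ⟨by simp only; omega, by simp only; omega⟩))
  have f3 := at_true h (s + 3) (by omega) ((fivePairVec_eq_true_iff _).2 (Or.inl ⟨by simp only; omega, le_rfl⟩))
  rw [fourThreeVec_eq_true_iff] at f0 f1 f2 f3; simp only at f0 f1 f2 f3
  omega

/-- A `{5,2}` vector is not a `{4,2,2}` vector. [cite: MadrasSlade1993, Definition 1.2.4; lane plumbing] -/
theorem fivePairVec_ne_fourTwoTwoVec {s q i q₂ q₂' : ℕ} (hs : s + 5 ≤ m) (_hq : (q + 2 ≤ s ∨ s + 5 ≤ q) ∧ q + 2 ≤ m) (_hi : i + 4 ≤ m) (hq₂ : SepAdj m i q₂)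
    (hq₂' : SepAdj m i q₂') (hqq : q₂ + 2 ≤ q₂') : fivePairVec m s q ≠ fourTwoTwoVec m i q₂ q₂' := by
  intro h
  unfold SepAdj at hq₂ hq₂'
  have f0 := at_true h s (by omega) ((fivePairVec_eq_true_iff _).2 (Or.inl ⟨le_rfl, by simp only; omega⟩))
  have f1 := at_true h (s + 1) (by omega) ((fivePairVec_eq_true_iff _).2 (Or.inl ⟨by simp only; omega, by simp only; omega⟩))
  have f2 := at_true h (s + 2) (by omega) ((fivePairVec_eq_true_iff _).2 (Or.inl ⟨by simp only; omega, by simp only; omega⟩))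
  have f3 := at_true h (s + 3) (by omega) ((fivePairVec_eq_true_iff _).2 (Or.inl ⟨by simp only; omega, le_rfl⟩))
  rw [fourTwoTwoVec_eq_true_iff] at f0 f1 f2 f3; simp only at f0 f1 f2 f3
  omega

/-- A `{4,3}` vector is not a `{4,2,2}` vector. [cite: MadrasSlade1993, Definition 1.2.4; lane plumbing] -/
theorem fourThreeVec_ne_fourTwoTwoVec {i q i₂ q₂ q₂' : ℕ} (hi : i + 4 ≤ m) (hq : (q + 3 ≤ i ∨ i + 4 ≤ q) ∧ q + 3 ≤ m) (_hi₂ : i₂ + 4 ≤ m) (hq₂ : SepAdj m i₂ q₂)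
    (hq₂' : SepAdj m i₂ q₂') (hqq : q₂ + 2 ≤ q₂') : fourThreeVec m i q ≠ fourTwoTwoVec m i₂ q₂ q₂' := by
  intro h
  unfold SepAdj at hq₂ hq₂'
  have f0 := at_true h i (by omega) ((fourThreeVec_eq_true_iff _).2 (Or.inl ⟨le_rfl, by simp only; omega⟩))
  have f1 := at_true h (i + 1) (by omega) ((fourThreeVec_eq_true_iff _).2 (Or.inl ⟨by simp only; omega, by simp only; omega⟩))
  have f2 := at_true h (i + 2) (by omega) ((fourThreeVec_eq_true_iff _).2 (Or.inl ⟨by simp only; omega, le_rfl⟩))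
  have f3 := at_true h q (by omega) ((fourThreeVec_eq_true_iff _).2 (Or.inr ⟨le_rfl, by simp only; omega⟩))
  have f4 := at_true h (q + 1) (by omega) ((fourThreeVec_eq_true_iff _).2 (Or.inr ⟨by simp only; omega, le_rfl⟩))
  rw [fourTwoTwoVec_eq_true_iff] at f0 f1 f2 f3 f4; simp only at f0 f1 f2 f3 f4
  omega

/-! ### ★ Classification of the five-adjacency vectors with a non-empty class -/

/-- ★ A valid adjacency vector with `m − 5` breaks and a non-empty class is of run type `{6}`, `{5,2}`, `{4,3}` or `{4,2,2}` (with the explicit parametrisations):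
the zero block carries three consecutive adjacencies, and the two remaining adjacencies extend the run or sit apart. [cite: MadrasSlade1993, Definition 1.2.4; lane lemma] -/
theorem exists_runType_of_mem_shapeClass {j : ℕ} {A : Fin m → Bool} (hb : breaks A + 5 = m) (hv : AdjValid A) {κ : Word m m} (hκ : κ ∈ shapeClass j m A) :
    (∃ s, s + 6 ≤ m ∧ A = sixRunVec m s) ∨ (∃ ab ∈ (Finset.range (m - 5)).offDiag, A = fivePairVec m (idx52 ab).1 (idx52 ab).2) ∨
      (∃ ab ∈ (Finset.range (m - 5)).offDiag, A = fourThreeVec m (idx43 ab).1 (idx43 ab).2) ∨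
      (∃ x ∈ tripleSlots (m - 5), A = fourTwoTwoVec m (idx422 x).1 (idx422 x).2.1 (idx422 x).2.2) := by
  classical
  rw [mem_shapeClass_iff] at hκ
  obtain ⟨-, -, -, hnr, a, a', haa', ha', hA, hpos⟩ := hκ
  have h4 := four_le_of_zero_block _ κ hnr haa' ha' hA hpos
  set T := Finset.univ.filter fun k : Fin m => A k = true with hT
  have hsum := Finset.card_filter_add_card_filter_not (s := (Finset.univ : Finset (Fin m))) (fun k : Fin m => A k = false)
  simp only [Finset.card_univ, Fintype.card_fin, Bool.not_eq_false] at hsum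
  have hT5 : T.card = 5 := by unfold breaks at hb; rw [hT]; omega
  have hmemT : ∀ x : Fin m, x ∈ T ↔ A x = true := fun x => by rw [hT, Finset.mem_filter]; simp
  have ht0 : A ⟨a, by omega⟩ = true := hA _ le_rfl (by simp only; omega)
  have ht1 : A ⟨a + 1, by omega⟩ = true := hA _ (by simp only; omega) (by simp only; omega)
  have ht2 : A ⟨a + 2, by omega⟩ = true := hA _ (by simp only; omega) (by simp only; omega)
  have hlast : A ⟨m - 1, by omega⟩ = false := hv (by omega)
  -- membership of a position in `T` as a function of its value
  have inT : ∀ (x : ℕ) (hx : x < m), A ⟨x, hx⟩ = true → (⟨x, hx⟩ : Fin m) ∈ T := fun x hx h => (hmemT _).2 h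
  -- a five-element superset determines `T`
  have detT : ∀ S : Finset (Fin m), S ⊆ T → S.card = 5 → ∀ x : Fin m, A x = true ↔ x ∈ S := by
    intro S hS hS5 x
    rw [← hmemT, Finset.eq_of_subset_of_card_le hS (by rw [hT5, hS5])]
  -- the last position is never an adjacency: bounds
  have bnd : ∀ (x : ℕ) (hx : x < m), A ⟨x, hx⟩ = true → x + 2 ≤ m := by
    intro x hx h
    by_contra hne
    have : (⟨x, hx⟩ : Fin m) = ⟨m - 1, by omega⟩ := Fin.ext (by simp only; omega)
    rw [this, hlast] at h
    exact Bool.false_ne_true h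
  have hz : bsumW κ a a' = 0 := (wordPos_eq_iff_bsumW κ haa'.le ha').1 hpos
  -- CASE 1: the block is longer than four: a six-run
  by_cases hlong : a + 6 ≤ a'
  · have ht3 : A ⟨a + 3, by omega⟩ = true := hA _ (by simp only; omega) (by simp only; omega)
    have ht4 : A ⟨a + 4, by omega⟩ = true := hA _ (by simp only; omega) (by simp only; omega)
    have hS : ({⟨a, by omega⟩, ⟨a + 1, by omega⟩, ⟨a + 2, by omega⟩, ⟨a + 3, by omega⟩, ⟨a + 4, by omega⟩} : Finset (Fin m)) ⊆ T := by
      intro x hx; simp only [Finset.mem_insert, Finset.mem_singleton] at hx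
      rcases hx with rfl | rfl | rfl | rfl | rfl
      · exact inT _ _ ht0
      · exact inT _ _ ht1
      · exact inT _ _ ht2
      · exact inT _ _ ht3
      · exact inT _ _ ht4
    have hS5 : ({⟨a, by omega⟩, ⟨a + 1, by omega⟩, ⟨a + 2, by omega⟩, ⟨a + 3, by omega⟩, ⟨a + 4, by omega⟩} : Finset (Fin m)).card = 5 := by
      rw [Finset.card_insert_of_notMem (by simp [Fin.ext_iff]), Finset.card_insert_of_notMem (by simp [Fin.ext_iff]),
        Finset.card_insert_of_notMem (by simp [Fin.ext_iff]), Finset.card_pair (by simp [Fin.ext_iff])]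
    have hAiff := detT _ hS hS5
    left
    refine ⟨a, by omega, funext fun x => ?_⟩
    rw [Bool.eq_iff_iff, hAiff x, sixRunVec_eq_true_iff]
    simp only [Finset.mem_insert, Finset.mem_singleton, Fin.ext_iff]
    omega
  -- otherwise the block has length exactly four
  have ha4 : a' = a + 4 := by
    by_contra hne
    have h5 : a' = a + 5 := by omega
    exact bsumW_ne_zero_of_odd κ ha' (by rw [h5]; omega) hz
  subst ha4
  -- the two remaining adjacencies
  set S3 : Finset (Fin m) := {⟨a, by omega⟩, ⟨a + 1, by omega⟩, ⟨a + 2, by omega⟩} with hS3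
  have hS3T : S3 ⊆ T := by
    intro x hx; rw [hS3] at hx; simp only [Finset.mem_insert, Finset.mem_singleton] at hx
    rcases hx with rfl | rfl | rfl
    · exact inT _ _ ht0
    · exact inT _ _ ht1
    · exact inT _ _ ht2
  have hS3c : S3.card = 3 := by rw [hS3, Finset.card_insert_of_notMem (by simp [Fin.ext_iff]), Finset.card_pair (by simp [Fin.ext_iff])]
  have hdiff : (T \ S3).card = 2 := by rw [Finset.card_sdiff_of_subset hS3T, hT5, hS3c]
  obtain ⟨u, v, huv, huvT⟩ := Finset.card_eq_two.1 hdiff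
  have hu : u ∈ T ∧ u ∉ S3 := by rw [← Finset.mem_sdiff, huvT]; simp
  have hvT : v ∈ T ∧ v ∉ S3 := by rw [← Finset.mem_sdiff, huvT]; simp
  have hTeq : ∀ x : Fin m, x ∈ T ↔ x ∈ S3 ∨ x = u ∨ x = v := by
    intro x
    constructor
    · intro hx
      by_cases hxS : x ∈ S3
      · exact Or.inl hxS
      · right; have : x ∈ T \ S3 := Finset.mem_sdiff.2 ⟨hx, hxS⟩; rw [huvT] at this; simpa using this
    · rintro (hx | rfl | rfl)
      · exact hS3T hx
      · exact hu.1
      · exact hvT.1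
  have hAiff : ∀ x : Fin m, A x = true ↔ (a ≤ x.val ∧ x.val ≤ a + 2) ∨ x.val = u.val ∨ x.val = v.val := by
    intro x
    rw [← hmemT x, hTeq x, hS3]
    simp only [Finset.mem_insert, Finset.mem_singleton, Fin.ext_iff]
    omega
  have huS : ¬ (a ≤ u.val ∧ u.val ≤ a + 2) := by
    intro h; apply hu.2; rw [hS3]; simp only [Finset.mem_insert, Finset.mem_singleton, Fin.ext_iff]; omega
  have hvS : ¬ (a ≤ v.val ∧ v.val ≤ a + 2) := by
    intro h; apply hvT.2; rw [hS3]; simp only [Finset.mem_insert, Finset.mem_singleton, Fin.ext_iff]; omega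
  have hum : u.val + 2 ≤ m := bnd u.val u.isLt ((hmemT u).1 hu.1)
  have hvm : v.val + 2 ≤ m := bnd v.val v.isLt ((hmemT v).1 hvT.1)
  have huv' : u.val ≠ v.val := fun h => huv (Fin.ext h)
  -- without loss of generality `t < t'`
  obtain ⟨t, t', htt, ht, ht', hAiff'⟩ : ∃ t t' : ℕ, t < t' ∧ (¬ (a ≤ t ∧ t ≤ a + 2) ∧ t + 2 ≤ m) ∧ (¬ (a ≤ t' ∧ t' ≤ a + 2) ∧ t' + 2 ≤ m) ∧
      ∀ x : Fin m, A x = true ↔ (a ≤ x.val ∧ x.val ≤ a + 2) ∨ x.val = t ∨ x.val = t' := by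
    rcases Nat.lt_or_gt_of_ne huv' with h | h
    · exact ⟨u.val, v.val, h, ⟨huS, hum⟩, ⟨hvS, hvm⟩, hAiff⟩
    · exact ⟨v.val, u.val, h, ⟨hvS, hvm⟩, ⟨huS, hum⟩, fun x => by rw [hAiff x]; omega⟩
  -- helper to conclude a vector identity from the characterisation
  have conclude : ∀ V : Fin m → Bool, (∀ x : Fin m, V x = true ↔ ((a ≤ x.val ∧ x.val ≤ a + 2) ∨ x.val = t ∨ x.val = t')) → A = V := by
    intro V hV; funext x; rw [Bool.eq_iff_iff, hAiff' x, hV x]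
  -- CASE ANALYSIS on the positions of `t < t'` relative to the block `{a, a+1, a+2}`
  by_cases h3 : t = a + 3 ∨ t' = a + 3
  · -- `a + 3` is an adjacency: a five-run `[a, a+5)`; the other adjacency `r`
    obtain ⟨r, hr, hAr⟩ : ∃ r : ℕ, (¬ (a ≤ r ∧ r ≤ a + 3) ∧ r + 2 ≤ m) ∧
        ∀ x : Fin m, A x = true ↔ ((a ≤ x.val ∧ x.val ≤ a + 3) ∨ x.val = r) := by
      rcases h3 with h | h
      · exact ⟨t', ⟨by omega, ht'.2⟩, fun x => by rw [hAiff' x]; omega⟩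
      · exact ⟨t, ⟨by omega, ht.2⟩, fun x => by rw [hAiff' x]; omega⟩
    by_cases hr4 : r = a + 4
    · -- six-run at `a`
      left; refine ⟨a, by omega, funext fun x => ?_⟩
      rw [Bool.eq_iff_iff, hAr x, sixRunVec_eq_true_iff]; omega
    by_cases hr1 : r + 1 = a
    · -- six-run at `a - 1`
      left; refine ⟨a - 1, by omega, funext fun x => ?_⟩
      rw [Bool.eq_iff_iff, hAr x, sixRunVec_eq_true_iff]; omega
    · -- `{5,2}` with `s = a`, `q = r` separated
      right; left
      have hsep : r + 2 ≤ a ∨ a + 5 ≤ r := by omega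
      rcases hsep with hlt | hgt
      · refine ⟨(a - 1, r), ?_, ?_⟩
        · rw [Finset.mem_offDiag, Finset.mem_range, Finset.mem_range]; simp only; omega
        · have hidx : idx52 (a - 1, r) = (a, r) := by
            unfold idx52; split_ifs with h
            · exact Prod.ext (by simp only; omega) rfl
            · exfalso; simp only at h; omega
          rw [hidx]; funext x; rw [Bool.eq_iff_iff, hAr x, fivePairVec_eq_true_iff]
      · refine ⟨(a, r - 4), ?_, ?_⟩
        · rw [Finset.mem_offDiag, Finset.mem_range, Finset.mem_range]; simp only; omega
        · have hidx : idx52 (a, r - 4) = (a, r) := by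
            unfold idx52; split_ifs with h
            · exfalso; simp only at h; omega
            · exact Prod.ext rfl (by simp only; omega)
          rw [hidx]; funext x; rw [Bool.eq_iff_iff, hAr x, fivePairVec_eq_true_iff]
  by_cases h1 : t + 1 = a ∨ t' + 1 = a
  · -- `a - 1` is an adjacency (and `a + 3` is not): a five-run `[a-1, a+4)`; the other adjacency `r ≠ a + 3`
    obtain ⟨r, hr, hAr⟩ : ∃ r : ℕ, (¬ (a ≤ r + 1 ∧ r ≤ a + 3) ∧ r + 2 ≤ m) ∧
        ∀ x : Fin m, A x = true ↔ ((a ≤ x.val + 1 ∧ x.val ≤ a + 2) ∨ x.val = r) := by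
      rcases h1 with h | h
      · exact ⟨t', ⟨by omega, ht'.2⟩, fun x => by rw [hAiff' x]; omega⟩
      · exact ⟨t, ⟨by omega, ht.2⟩, fun x => by rw [hAiff' x]; omega⟩
    have ha1 : 1 ≤ a := by omega
    by_cases hr2 : r + 2 = a
    · -- six-run at `a - 2`
      left; refine ⟨a - 2, by omega, funext fun x => ?_⟩
      rw [Bool.eq_iff_iff, hAr x, sixRunVec_eq_true_iff]; omega
    · -- `{5,2}` with `s = a - 1`, `q = r`
      right; left
      have hsep : r + 3 ≤ a ∨ a + 4 ≤ r := by omega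
      rcases hsep with hlt | hgt
      · refine ⟨(a - 2, r), ?_, ?_⟩
        · rw [Finset.mem_offDiag, Finset.mem_range, Finset.mem_range]; simp only; omega
        · have hidx : idx52 (a - 2, r) = (a - 1, r) := by
            unfold idx52; split_ifs with h
            · exact Prod.ext (by simp only; omega) rfl
            · exfalso; simp only at h; omega
          rw [hidx]; funext x; rw [Bool.eq_iff_iff, hAr x, fivePairVec_eq_true_iff]; omega
      · refine ⟨(a - 1, r - 4), ?_, ?_⟩
        · rw [Finset.mem_offDiag, Finset.mem_range, Finset.mem_range]; simp only; omega
        · have hidx : idx52 (a - 1, r - 4) = (a - 1, r) := by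
            unfold idx52; split_ifs with h
            · exfalso; simp only at h; omega
            · exact Prod.ext rfl (by simp only; omega)
          rw [hidx]; funext x; rw [Bool.eq_iff_iff, hAr x, fivePairVec_eq_true_iff]; omega
  -- neither `a - 1` nor `a + 3` is an adjacency: `t, t'` are separated from the block
  have hts : t + 2 ≤ a ∨ a + 4 ≤ t := by omega
  have ht's : t' + 2 ≤ a ∨ a + 4 ≤ t' := by omega
  by_cases hadj : t' = t + 1
  · -- `{4,3}` with `i = a`, `q = t`
    subst hadj
    right; right; left
    rcases hts with hlt | hgt
    · refine ⟨(a - 2, t), ?_, ?_⟩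
      · rw [Finset.mem_offDiag, Finset.mem_range, Finset.mem_range]; simp only; omega
      · have hidx : idx43 (a - 2, t) = (a, t) := by
          unfold idx43; split_ifs with h
          · exact Prod.ext (by simp only; omega) rfl
          · exfalso; simp only at h; omega
        rw [hidx]; exact conclude _ (fun x => by rw [fourThreeVec_eq_true_iff]; simp only; omega)
    · refine ⟨(a, t - 3), ?_, ?_⟩
      · rw [Finset.mem_offDiag, Finset.mem_range, Finset.mem_range]; simp only; omega
      · have hidx : idx43 (a, t - 3) = (a, t) := by
          unfold idx43; split_ifs with h
          · exfalso; simp only at h; omega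
          · exact Prod.ext rfl (by simp only; omega)
        rw [hidx]; exact conclude _ (fun x => by rw [fourThreeVec_eq_true_iff]; simp only; omega)
  · -- `{4,2,2}` with `i = a`, `q = t`, `q' = t'`, `t + 2 ≤ t'`
    have hgap : t + 2 ≤ t' := by omega
    right; right; right
    -- the slot triple by the three relative positions
    rcases hts with hlt | hgt
    · rcases ht's with hlt' | hgt'
      · -- both before the block
        refine ⟨⟨(t, t' - 1), a - 2⟩, ?_, ?_⟩
        · rw [mem_tripleSlots]; simp only; omega
        · have hidx : idx422 ⟨(t, t' - 1), a - 2⟩ = (a, t, t') := by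
            unfold idx422; simp only; split_ifs <;> simp only [Prod.mk.injEq] <;> omega
          rw [hidx]; exact conclude _ (fun x => by rw [fourTwoTwoVec_eq_true_iff])
      · -- `t` before, `t'` after
        refine ⟨⟨(t, t' - 4), a - 1⟩, ?_, ?_⟩
        · rw [mem_tripleSlots]; simp only; omega
        · have hidx : idx422 ⟨(t, t' - 4), a - 1⟩ = (a, t, t') := by
            unfold idx422; simp only; split_ifs <;> simp only [Prod.mk.injEq] <;> omega
          rw [hidx]; exact conclude _ (fun x => by rw [fourTwoTwoVec_eq_true_iff])
    · -- both after the block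
      refine ⟨⟨(t - 3, t' - 4), a⟩, ?_, ?_⟩
      · rw [mem_tripleSlots]; simp only; omega
      · have hidx : idx422 ⟨(t - 3, t' - 4), a⟩ = (a, t, t') := by
          unfold idx422; simp only; split_ifs <;> simp only [Prod.mk.injEq] <;> omega
        rw [hidx]; exact conclude _ (fun x => by rw [fourTwoTwoVec_eq_true_iff])

/-! ### ★★★ The third-layer top census -/

open Classical in
/-- ★★★ THE THIRD-LAYER TOP CENSUS FOR EVERY `j ≥ 3`: with `N_j = (2j−5)(j−3)(2j−7)` (the `{4,2,2}` placements) and `a, b, c = (2j−5)‼, (2j−7)‼, (2j−9)‼`,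
`T'_j + ((2j−5)(1 + 2(2j−6)) + N_j)·2b·2^{2j−3} = (2j−5)(3a·2^{2j−2} + 4b·2^{2j−3}) + (2j−5)(2j−6)(a·2^{2j−1} + a·2^{2j−2}) + N_j(a·2^{2j−2} + c·2^{2j−4})`,
`T'_j = thirdShapeSumTop j`
— the classes on `2j` letters with five adjacencies are the `2j−5` six-run classes, the `(2j−5)(2j−6)` classes of type `{5,2}`, as many of type `{4,3}`, and the `N_j` of type `{4,2,2}`
(`T'_3 … T'_8 = 64, 5040, 355200, 24380160, 1753436160, 135440363520`; BR-2 = `T'_8`). [cite: MadrasSlade1993, §1.1 eq. (1.1.8) p. 5; Definition 1.2.4]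
[cite: ClisbyLiangSlade2007, §3.3 eqs. (29)/(31); lane theorem] -/
theorem thirdShapeSumTop_add (j : ℕ) (hj : 3 ≤ j) :
    thirdShapeSumTop j + ((2 * j - 5) * (1 + 2 * (2 * j - 6)) + (2 * j - 5) * (j - 3) * (2 * j - 7)) * (2 * ((2 * j - 7).doubleFactorial * 2 ^ (2 * j - 3))) =
      (2 * j - 5) * (3 * ((2 * j - 5).doubleFactorial * 2 ^ (2 * j - 2)) + 4 * ((2 * j - 7).doubleFactorial * 2 ^ (2 * j - 3))) +
      (2 * j - 5) * (2 * j - 6) * ((2 * j - 5).doubleFactorial * 2 ^ (2 * j - 1) + (2 * j - 5).doubleFactorial * 2 ^ (2 * j - 2)) +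
      (2 * j - 5) * (j - 3) * (2 * j - 7) * ((2 * j - 5).doubleFactorial * 2 ^ (2 * j - 2) + (2 * j - 9).doubleFactorial * 2 ^ (2 * j - 4)) := by
  unfold thirdShapeSumTop
  set m := 2 * j with hm
  set f : (Fin m → Bool) → ℕ := fun A => if AdjValid A ∧ breaks A = 2 * j - 5 then (shapeClass j m A).card else 0 with hf
  set n := m - 5 with hn
  set I6 := (Finset.range n).image (sixRunVec m) with hI6
  set I52 := ((Finset.range n).offDiag).image (fun ab => fivePairVec m (idx52 ab).1 (idx52 ab).2) with hI52
  set I43 := ((Finset.range n).offDiag).image (fun ab => fourThreeVec m (idx43 ab).1 (idx43 ab).2) with hI43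
  set I422 := (tripleSlots n).image (fun x => fourTwoTwoVec m (idx422 x).1 (idx422 x).2.1 (idx422 x).2.2) with hI422
  have hn5 : n + 5 = m := by omega
  -- abbreviations for the counts
  set B2 := 2 * ((2 * j - 7).doubleFactorial * 2 ^ (2 * j - 3)) with hB2
  set V6 := 3 * ((2 * j - 5).doubleFactorial * 2 ^ (2 * j - 2)) + 4 * ((2 * j - 7).doubleFactorial * 2 ^ (2 * j - 3)) with hV6
  set V52 := (2 * j - 5).doubleFactorial * 2 ^ (2 * j - 1) with hV52
  set V43 := (2 * j - 5).doubleFactorial * 2 ^ (2 * j - 2) with hV43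
  set V422 := (2 * j - 5).doubleFactorial * 2 ^ (2 * j - 2) + (2 * j - 9).doubleFactorial * 2 ^ (2 * j - 4) with hV422
  -- every other vector contributes nothing
  have hvan : ∀ A ∈ (Finset.univ : Finset (Fin m → Bool)), A ∉ I6 ∪ I52 ∪ I43 ∪ I422 → f A = 0 := by
    intro A _ hA
    rw [hf]; simp only
    split_ifs with h
    · by_contra hne
      obtain ⟨κ, hκ⟩ := Finset.card_pos.1 (Nat.pos_of_ne_zero hne)
      rcases exists_runType_of_mem_shapeClass (by rw [h.2]; omega) h.1 hκ with ⟨s, hs, rfl⟩ | ⟨ab, hab, rfl⟩ | ⟨ab, hab, rfl⟩ | ⟨x, hx, rfl⟩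
      · exact hA (Finset.mem_union_left _ (Finset.mem_union_left _ (Finset.mem_union_left _ (Finset.mem_image.2 ⟨s, Finset.mem_range.2 (by omega), rfl⟩))))
      · exact hA (Finset.mem_union_left _ (Finset.mem_union_left _ (Finset.mem_union_right _ (Finset.mem_image.2 ⟨ab, hab, rfl⟩))))
      · exact hA (Finset.mem_union_left _ (Finset.mem_union_right _ (Finset.mem_image.2 ⟨ab, hab, rfl⟩)))
      · exact hA (Finset.mem_union_right _ (Finset.mem_image.2 ⟨x, hx, rfl⟩))
    · rfl
  -- injectivity of the four parametrisations
  have hinj6 : Set.InjOn (sixRunVec m) ↑(Finset.range n) := by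
    intro s hs s' hs' h
    rw [Finset.mem_coe, Finset.mem_range] at hs hs'
    exact sixRunVec_inj (by omega) (by omega) h
  have hinj52 : Set.InjOn (fun ab => fivePairVec m (idx52 ab).1 (idx52 ab).2) ↑((Finset.range n).offDiag) := by
    intro ab hab ab' hab' h
    rw [Finset.mem_coe] at hab hab'
    obtain ⟨h1, h2⟩ := idx52_spec hab
    obtain ⟨h1', h2'⟩ := idx52_spec hab'
    obtain ⟨e1, e2⟩ := fivePairVec_inj h1 h2 h1' h2' h
    exact idx52_inj (Prod.ext e1 e2)
  have hinj43 : Set.InjOn (fun ab => fourThreeVec m (idx43 ab).1 (idx43 ab).2) ↑((Finset.range n).offDiag) := by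
    intro ab hab ab' hab' h
    rw [Finset.mem_coe] at hab hab'
    obtain ⟨h1, h2⟩ := idx43_spec hab
    obtain ⟨h1', h2'⟩ := idx43_spec hab'
    obtain ⟨e1, e2⟩ := fourThreeVec_inj h1 h2 h1' h2' h
    exact idx43_inj (Prod.ext e1 e2)
  have hinj422 : Set.InjOn (fun x => fourTwoTwoVec m (idx422 x).1 (idx422 x).2.1 (idx422 x).2.2) ↑(tripleSlots n) := by
    intro x hx x' hx' h
    rw [Finset.mem_coe] at hx hx'
    obtain ⟨h1, h2, h3, h4⟩ := idx422_spec hn5 hx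
    obtain ⟨h1', h2', h3', h4'⟩ := idx422_spec hn5 hx'
    obtain ⟨e1, e2, e3⟩ := fourTwoTwoVec_inj h1 h2 h3 h4 h1' h2' h3' h4' h
    exact idx422_inj hx hx' (Prod.ext e1 (Prod.ext e2 e3))
  -- pairwise disjointness of the images
  have hd1 : Disjoint I6 I52 := by
    rw [Finset.disjoint_left]; intro A h6 h52
    obtain ⟨s, hs, rfl⟩ := Finset.mem_image.1 h6
    obtain ⟨ab, hab, heq⟩ := Finset.mem_image.1 h52
    rw [Finset.mem_range] at hs
    obtain ⟨h1, h2⟩ := idx52_spec hab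
    exact sixRunVec_ne_fivePairVec (by omega) h1 h2 heq.symm
  have hd2 : Disjoint (I6 ∪ I52) I43 := by
    rw [Finset.disjoint_left]; intro A h h43
    obtain ⟨ab, hab, heq⟩ := Finset.mem_image.1 h43
    obtain ⟨h1, h2⟩ := idx43_spec hab
    rcases Finset.mem_union.1 h with h6 | h52
    · obtain ⟨s, hs, rfl⟩ := Finset.mem_image.1 h6
      rw [Finset.mem_range] at hs
      exact sixRunVec_ne_fourThreeVec (by omega) h1 h2 heq.symm
    · obtain ⟨ab', hab', rfl⟩ := Finset.mem_image.1 h52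
      obtain ⟨h1', h2'⟩ := idx52_spec hab'
      exact fivePairVec_ne_fourThreeVec h1' h2' h1 h2 heq.symm
  have hd3 : Disjoint (I6 ∪ I52 ∪ I43) I422 := by
    rw [Finset.disjoint_left]; intro A h h422
    obtain ⟨x, hx, heq⟩ := Finset.mem_image.1 h422
    obtain ⟨h1, h2, h3, h4⟩ := idx422_spec hn5 hx
    rcases Finset.mem_union.1 h with h | h43
    · rcases Finset.mem_union.1 h with h6 | h52
      · obtain ⟨s, hs, rfl⟩ := Finset.mem_image.1 h6
        rw [Finset.mem_range] at hs
        exact sixRunVec_ne_fourTwoTwoVec (by omega) h1 h2 h3 h4 heq.symm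
      · obtain ⟨ab', hab', rfl⟩ := Finset.mem_image.1 h52
        obtain ⟨h1', h2'⟩ := idx52_spec hab'
        exact fivePairVec_ne_fourTwoTwoVec h1' h2' h1 h2 h3 h4 heq.symm
    · obtain ⟨ab', hab', rfl⟩ := Finset.mem_image.1 h43
      obtain ⟨h1', h2'⟩ := idx43_spec hab'
      exact fourThreeVec_ne_fourTwoTwoVec h1' h2' h1 h2 h3 h4 heq.symm
  -- the values on the four families
  have hval6 : ∀ s ∈ Finset.range n, f (sixRunVec m s) + B2 = V6 := by
    intro s hs
    rw [Finset.mem_range] at hs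
    rw [hf]; simp only
    rw [if_pos ⟨adjValid_sixRunVec (by omega), (breaks_sixRunVec (by omega)).trans (by omega)⟩]
    exact card_shapeClass_sixRunVec hj (by omega)
  have hval52 : ∀ ab ∈ (Finset.range n).offDiag, f (fivePairVec m (idx52 ab).1 (idx52 ab).2) + B2 = V52 := by
    intro ab hab
    obtain ⟨h1, h2⟩ := idx52_spec hab
    rw [hf]; simp only
    rw [if_pos ⟨adjValid_fivePairVec h1 h2.2, (breaks_fivePairVec h1 h2).trans (by omega)⟩]
    exact card_shapeClass_fivePairVec hj h1 h2
  have hval43 : ∀ ab ∈ (Finset.range n).offDiag, f (fourThreeVec m (idx43 ab).1 (idx43 ab).2) + B2 = V43 := by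
    intro ab hab
    obtain ⟨h1, h2⟩ := idx43_spec hab
    rw [hf]; simp only
    rw [if_pos ⟨adjValid_fourThreeVec h1 h2.2, (breaks_fourThreeVec h1 h2).trans (by omega)⟩]
    exact card_shapeClass_fourThreeVec hj h1 h2
  have hval422 : ∀ x ∈ tripleSlots n, f (fourTwoTwoVec m (idx422 x).1 (idx422 x).2.1 (idx422 x).2.2) + B2 = V422 := by
    intro x hx
    obtain ⟨h1, h2, h3, h4⟩ := idx422_spec hn5 hx
    have hj4 : 4 ≤ j := by
      have := (mem_tripleSlots.1 hx); unfold SepAdj at h2 h3; omega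
    rw [hf]; simp only
    rw [if_pos ⟨adjValid_fourTwoTwoVec h1 h2.2 h3.2, (breaks_fourTwoTwoVec h1 h2 h3 h4).trans (by omega)⟩]
    exact card_shapeClass_fourTwoTwoVec hj4 h1 h2 h3 h4
  -- cardinalities of the index sets
  have hcn : (Finset.range n).card = 2 * j - 5 := by rw [Finset.card_range]
  have hcoff : ((Finset.range n).offDiag).card = (2 * j - 5) * (2 * j - 6) := by
    rw [Finset.offDiag_card, Finset.card_range, show n = 2 * j - 5 by omega]
    rcases Nat.lt_or_ge j 4 with h | h
    · have h1 : 2 * j - 5 = 1 := by omega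
      have h2 : 2 * j - 6 = 0 := by omega
      rw [h1, h2]
    · have h5 : 2 * j - 5 = (2 * j - 6) + 1 := by omega
      rw [h5]; exact Nat.sub_eq_of_eq_add (by ring)
  have hc422 : (tripleSlots n).card = (2 * j - 5) * (j - 3) * (2 * j - 7) := by
    rw [card_tripleSlots, show n = 2 * j - 5 by omega, show 2 * j - 5 - 1 = 2 * (j - 3) by omega, show 2 * j - 5 - 2 = 2 * j - 7 by omega,
      show (2 * j - 5) * (2 * (j - 3)) = (2 * j - 5) * (j - 3) * 2 by ring, Nat.mul_div_cancel _ two_pos]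
  -- sums over each family
  have hsum_family : ∀ {ι : Type} (S : Finset ι) (g : ι → (Fin m → Bool)) (V : ℕ), (∀ x ∈ S, f (g x) + B2 = V) →
      ∑ x ∈ S, f (g x) + S.card * B2 = S.card * V := by
    intro ι S g V hV
    rw [Finset.card_eq_sum_ones, Finset.sum_mul, Finset.sum_mul, ← Finset.sum_add_distrib]
    refine Finset.sum_congr rfl fun x hx => ?_
    rw [one_mul, one_mul]; exact hV x hx
  have step1 : ∑ A, f A = ∑ s ∈ Finset.range n, f (sixRunVec m s) + ∑ ab ∈ (Finset.range n).offDiag, f (fivePairVec m (idx52 ab).1 (idx52 ab).2) +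
      ∑ ab ∈ (Finset.range n).offDiag, f (fourThreeVec m (idx43 ab).1 (idx43 ab).2) +
      ∑ x ∈ tripleSlots n, f (fourTwoTwoVec m (idx422 x).1 (idx422 x).2.1 (idx422 x).2.2) := by
    rw [← Finset.sum_subset (Finset.subset_univ _) hvan, Finset.sum_union hd3, Finset.sum_union hd2, Finset.sum_union hd1, Finset.sum_image hinj6,
      Finset.sum_image hinj52, Finset.sum_image hinj43, Finset.sum_image hinj422]
  have s6 := hsum_family _ _ _ hval6
  have s52 := hsum_family _ _ _ hval52
  have s43 := hsum_family _ _ _ hval43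
  have s422 := hsum_family _ _ _ hval422
  rw [hcn] at s6; rw [hcoff] at s52 s43; rw [hc422] at s422
  rw [show (∑ A, f A) = Finset.univ.sum f from rfl] at step1
  show Finset.univ.sum f + _ = _
  rw [step1]
  set S6 := ∑ s ∈ Finset.range n, f (sixRunVec m s)
  set S52 := ∑ ab ∈ (Finset.range n).offDiag, f (fivePairVec m (idx52 ab).1 (idx52 ab).2)
  set S43 := ∑ ab ∈ (Finset.range n).offDiag, f (fourThreeVec m (idx43 ab).1 (idx43 ab).2)
  set S422 := ∑ x ∈ tripleSlots n, f (fourTwoTwoVec m (idx422 x).1 (idx422 x).2.1 (idx422 x).2.2)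
  calc S6 + S52 + S43 + S422 + ((2 * j - 5) * (1 + 2 * (2 * j - 6)) + (2 * j - 5) * (j - 3) * (2 * j - 7)) * B2
      = (S6 + (2 * j - 5) * B2) + (S52 + (2 * j - 5) * (2 * j - 6) * B2) + (S43 + (2 * j - 5) * (2 * j - 6) * B2) +
        (S422 + (2 * j - 5) * (j - 3) * (2 * j - 7) * B2) := by ring
    _ = (2 * j - 5) * V6 + (2 * j - 5) * (2 * j - 6) * V52 + (2 * j - 5) * (2 * j - 6) * V43 + (2 * j - 5) * (j - 3) * (2 * j - 7) * V422 := by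
        rw [s6, s52, s43, s422]
    _ = _ := by rw [hV6, hV52, hV43, hV422]; ring

/-- The instances `j = 3, …, 8`: `T'_3 = 64`, `T'_4 = 5040`, `T'_5 = 355200`, `T'_6 = 24380160`, `T'_7 = 1 753 436 160`, `T'_8 = 135 440 363 520` (BR-2).
[cite: MadrasSlade1993, Definition 1.2.4; lane theorem] -/
theorem thirdShapeSumTop_values :
    thirdShapeSumTop 3 = 64 ∧ thirdShapeSumTop 4 = 5040 ∧ thirdShapeSumTop 5 = 355200 ∧ thirdShapeSumTop 6 = 24380160 ∧ thirdShapeSumTop 7 = 1753436160 ∧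
      thirdShapeSumTop 8 = 135440363520 := by
  have h3 := thirdShapeSumTop_add 3 le_rfl
  have h4 := thirdShapeSumTop_add 4 (by norm_num)
  have h5 := thirdShapeSumTop_add 5 (by norm_num)
  have h6 := thirdShapeSumTop_add 6 (by norm_num)
  have h7 := thirdShapeSumTop_add 7 (by norm_num)
  have h8 := thirdShapeSumTop_add 8 (by norm_num)
  norm_num [Nat.doubleFactorial] at h3 h4 h5 h6 h7 h8
  omega

end WordTypes

end Literature.Probability.RandomPlanarGeometry.SAW.Zd
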